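import Mathlib
import HarnessLib

/-!
# Route `RadicialJung`, crux `CleanModels` (stmt-ResolutionOfSingularities-15917), line `Sketch` rev 35, stub 6 `stub_cleanProp44` (X44c):
# census (M), second brick — BIRTH TREES ARE FINITE: a finitely branching «child» relation along which a ℕ-valued weight strictly drops has finitely
# many descendants from every root, and no infinite chains

Seat decomp-res-hand-2 g23 (structural hand).  The `δ`-descent of one birth-chain generation (✓ `birth_descent_intrinsic`, hand-2 g21) and the weighted
leaf order `w(c)` (✓ `exists_greatest_leafOrder`, census (M) first brick) give, for the relation «`c′` is a near point born on the exceptional divisor of the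
σ-tower over `c`» of memo 4e §2.4–2.6: `w(c′) ≤ w(c) − 1` (✓ `descent_lt` read with `d′ := w(c′)`), and every generation is a finite set of closed points.
The termination statement the Phase II bookkeeping (R1ᵐⁱⁿ) consumes is then pure combinatorics, recorded here def-free for an abstract relation `R`
(«`b` is a child of `a`») and weight `w`:

* `transGen_weight_lt` — along a chain of births the weight drops: `R⁺ a b → w b < w a`; hence chains from `a` have length `≤ w a`
  (`length_add_weight_le_of_isChain`).
* `wellFounded_flip_of_weight` — there is no infinite sequence of successive births.
* `setOf_transGen_eq_biUnion` / **`finite_setOf_transGen_of_weight`** — if every point has finitely many children then every point has FINITELY MANY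
  DESCENDANTS (strong induction on the weight; no König lemma needed since the depth is bounded).

Honest framing: OURS, elementary; the identification of `R` with the birth relation of the σ-tower and of `w` with the weighted leaf order is the (M)/(S4)
bookkeeping of the termination author; nothing here proves X44c, any case of `CleanModels`, or resolution of singularities in characteristic `p`.
[cite: CossartPiltant2008, Prop. 4.4 (proof, p. 11)] [cite: CossartJannsenSaito2020, Lemma 7.5]
-/

set_option linter.dupNamespace false -- mandated namespace of this single-conjunct summit

namespace Summit.ResolutionOfSingularities.ResolutionOfSingularities.Theorems.RadicialJung.CleanModels

section BirthTree

variable {α : Type*} (R : α → α → Prop) (w : α → ℕ) (hw : ∀ a b, R a b → w b < w a)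

include hw

/-- Along a chain of births the weight strictly drops. [folklore] -/
theorem transGen_weight_lt {a b : α} (h : Relation.TransGen R a b) : w b < w a := by
  induction h with
  | single hab => exact hw _ _ hab
  | tail _ hbc ih => exact lt_trans (hw _ _ hbc) ih

/-- No point is its own descendant. [folklore] -/
theorem not_transGen_self (a : α) : ¬ Relation.TransGen R a a := fun h =>
  lt_irrefl _ (transGen_weight_lt R w hw h)

/-- **No infinite sequence of successive births**: the converse relation is well founded. [folklore] -/
theorem wellFounded_flip_of_weight : WellFounded (fun b a => R a b) :=
  Subrelation.wf (fun {b a} (h : R a b) => hw a b h) (measure w).wf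

/-- A chain `a → c₁ → ⋯ → c_n` of successive births has `n + w(c_n) ≤ w(a)`; in particular its length is at most `w a`. [folklore] -/
theorem length_add_weight_le_of_isChain (a : α) (l : List α) (h : List.IsChain R (a :: l)) :
    l.length + w ((a :: l).getLast (List.cons_ne_nil a l)) ≤ w a := by
  induction l generalizing a with
  | nil => simp
  | cons c l ih =>
    rw [List.isChain_cons_cons] at h
    have h1 := ih c h.2
    have h2 := hw a c h.1
    have hlast : (a :: c :: l).getLast (List.cons_ne_nil a (c :: l)) = (c :: l).getLast (List.cons_ne_nil c l) := by
      rw [List.getLast_cons (List.cons_ne_nil c l)]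
    rw [hlast, List.length_cons]
    omega

omit hw in
/-- The descendants of `a` are its children together with their descendants. [folklore] -/
theorem setOf_transGen_eq_biUnion (a : α) :
    {b | Relation.TransGen R a b} = ⋃ c ∈ {c | R a c}, ({c} ∪ {b | Relation.TransGen R c b}) := by
  ext b
  simp only [Set.mem_setOf_eq, Set.mem_iUnion, Set.mem_union, Set.mem_singleton_iff, exists_prop]
  rw [Relation.TransGen.head'_iff]
  refine exists_congr fun c => and_congr_right fun _ => ?_
  rw [Relation.reflTransGen_iff_eq_or_transGen]

/-- **Birth trees are finite**: if every point has finitely many children and the weight drops along `R`, every point has finitely many descendants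
(strong induction on `w a`). [folklore] -/
theorem finite_setOf_transGen_of_weight (hfin : ∀ a, {b | R a b}.Finite) : ∀ a, {b | Relation.TransGen R a b}.Finite := by
  suffices h : ∀ n (a : α), w a = n → {b | Relation.TransGen R a b}.Finite from fun a => h (w a) a rfl
  intro n
  induction n using Nat.strong_induction_on with
  | _ n ih =>
    intro a ha
    rw [setOf_transGen_eq_biUnion R a]
    refine (hfin a).biUnion fun c hc => (Set.finite_singleton c).union ?_
    exact ih (w c) (by rw [← ha]; exact hw a c hc) c rfl

/-- Hence the set of all points of the tree below `a` (including `a`) is finite, with the reflexive-transitive closure. [folklore] -/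
theorem finite_setOf_reflTransGen_of_weight (hfin : ∀ a, {b | R a b}.Finite) (a : α) : {b | Relation.ReflTransGen R a b}.Finite := by
  have h : {b | Relation.ReflTransGen R a b} = {a} ∪ {b | Relation.TransGen R a b} := by
    ext b
    simp only [Set.mem_setOf_eq, Set.mem_union, Set.mem_singleton_iff]
    rw [Relation.reflTransGen_iff_eq_or_transGen]
  rw [h]
  exact (Set.finite_singleton a).union (finite_setOf_transGen_of_weight R w hw hfin a)

end BirthTree

end Summit.ResolutionOfSingularities.ResolutionOfSingularities.Theorems.RadicialJung.CleanModels
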